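import Mathlib
import HarnessLib
import Literature.AlgebraicGeometry.Ramification.InertiaNormalSylow
import Literature.AlgebraicGeometry.Ramification.InertiaStalkNormalSylow
import Summits.ResolutionOfSingularities.ResolutionOfSingularities.Theorems.WildQuotientsWildQuotientResolutionStubPointBlowupStalkData
import Summits.ResolutionOfSingularities.ResolutionOfSingularities.Theorems.WildQuotientsWildQuotientResolutionInertLocusStalk
import Summits.ResolutionOfSingularities.ResolutionOfSingularities.Theorems.WildQuotientsWildQuotientResolutionTameEndStateFlag

/-!
# The TORAL END STATE of Phase 0 at the scheme level: tame elements toral w.r.t. a stable boundary ⟹ p-closed inertia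
# (crux `WildQuotients.WildQuotientResolution`, stub `stub_phaseZeroHighDim`; any dimension)

Crux stmt-ResolutionOfSingularities-15640 (`WildQuotientResolution`), registered stub `stub_phaseZeroHighDim`
(a `G`-equivariant proper birational REGULAR model all of whose inertia groups are p-closed). The local criteria
✓`TameEndState.hasNormalSylow_of_tame_trivial_mod_boundary` (p817841) / ✓`…_of_boundary_flag_kernel` (p819336)
are stated for an abstract faithful residue-trivial action `τ` on a local ring. This file transports them to the
INERTIA GROUP `I_x` OF A POINT OF A `G`-SCHEME, through the stalk action of ✓`PointBlowupStalkData.exists_stalkAction`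
(`Spec(a_g) ≫ ι_x = ι_x ≫ ρ g`, `τ g = a_{g⁻¹}`), whose two structural properties are proved here once and for
all: it is FAITHFUL (`stalkAction_injective`: integral `X`, faithful `ρ` over a separated invariant base,
✓`eq_one_of_fromSpecStalk_comp_eq`) and RESIDUE-TRIVIAL (`stalkAction_residueTrivial`: ✓`InertLocusStalk` p819500
at the closed point). Consequently:

**Theorem** (`hasNormalSylow_inertia_of_toralBoundary`). Let `G` (finite) act faithfully on the integral locally
Noetherian `X` over the separated `r : X → Y`, and let `x ∈ X` have residue characteristic `p`. Suppose that for
the stalk action of `I_x` on `𝒪_{X,x}` there are `z₁, …, z_n ∈ 𝔪_x` — local equations of boundary divisors /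
mirrors through `x` — with `(zᵢ) + 𝔪²` stable under `I_x` and every element of `I_x` of order prime to `p` acting
trivially on `𝔪_x / ((z) + 𝔪_x²)` (the tame part of `I_x` is TORAL with respect to the boundary at `x`). Then `I_x`
has a normal Sylow `p`-subgroup. Variants: top piece a line (`…_of_boundaryCorankLEOne`), vertex
(`…_of_stableParameters`).

So `stub_phaseZeroHighDim` in ANY dimension follows from a TAME TOROIDALISATION: an equivariant sequence of blow-ups
in regular `G`-stable centres (e.g. ✓`tameMove`, p819797) after which, at every point, the tame cyclic subgroups
of the inertia group are toral with respect to the (`G`-stable, hence branchwise `I_x`-stable) boundary — a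
statement in which only TAME subgroups and their REGULAR fixed loci occur (✓`TameFixedLocus`), no wild fixed locus
ever being a centre. Evidence memo PHASE0-TAME-CENTRE-ORDER.md (item 15640) records why the ORDER of such centres
matters (loops for `Fix(O_{p′}(I_x))` on `𝔸⁴`, and for point centres at p-closed points of `μ₄` on the plane).

[OURS · crux stmt-ResolutionOfSingularities-15640 · helper toward `stub_phaseZeroHighDim` (scheme-level end state of
the all-dimensional tame layer; NOT a proof of the stub); folklore, counted 0; AI-level work, weaker than expert
review.] [folklore; cf. AbbesSaito2011, 2.4]
-/

-- single-problem summit: the doubled namespace component `ResolutionOfSingularities` is forced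
set_option linter.dupNamespace false

noncomputable section

namespace Summit.ResolutionOfSingularities.ResolutionOfSingularities.Theorems.WildQuotientResolution.InertLocusStalk

open CategoryTheory AlgebraicGeometry TopologicalSpace IsLocalRing
open Literature.AlgebraicGeometry.Resolution Literature.AlgebraicGeometry.Ramification
open Summit.ResolutionOfSingularities.ResolutionOfSingularities.Theorems.WildQuotientResolution.PointBlowupStalkData

/-! ## The stalk action of the inertia group: faithful and residue-trivial -/

section StalkAction

variable {X : Scheme.{0}} {G : Type} [Group G] (σ : G →* Aut X) (x : X)
  {I : Subgroup G}
  (a : I → (X.presheaf.stalk x ⟶ X.presheaf.stalk x))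
  (τ : I →* (X.presheaf.stalk x ≃+* X.presheaf.stalk x))
  (hkey : ∀ g : I, Spec.map (a g) ≫ X.fromSpecStalk x = X.fromSpecStalk x ≫ (σ (g : G)).hom)
  (hτ : ∀ (g : I) (r : X.presheaf.stalk x), τ g r = (a g⁻¹).hom r)

include hkey hτ

/-- **The stalk action is faithful**: for an integral `X` with a faithful action over a separated invariant
`r : X → Y`, the stalk action `τ` of a subgroup fixing `x` on `𝒪_{X,x}` is injective (the local scheme
`Spec 𝒪_{X,x} → X` is dominant; ✓`eq_one_of_fromSpecStalk_comp_eq`). [folklore] -/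
theorem stalkAction_injective [IsIntegral X] {Y : Scheme.{0}} (r : X ⟶ Y) [IsSeparated r]
    (hr : ∀ g : G, (σ g).hom ≫ r = r) (hσ : Function.Injective σ) : Function.Injective τ := by
  rw [injective_iff_map_eq_one]
  intro g hg
  have h1 : a g⁻¹ = 𝟙 _ := by
    ext y
    have := RingEquiv.congr_fun hg y
    rw [hτ] at this
    simpa using this
  have h2 : X.fromSpecStalk x ≫ (σ ((g⁻¹ : I) : G)).hom = X.fromSpecStalk x := by
    rw [← hkey, h1, Spec.map_id, Category.id_comp]
  have h3 : ((g⁻¹ : I) : G) = 1 := eq_one_of_fromSpecStalk_comp_eq σ r hr hσ x _ h2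
  have : (g⁻¹ : I) = 1 := Subtype.ext h3
  exact inv_eq_one.mp this

/-- **The stalk action of the inertia group is residue-trivial**: for `I ≤ I_x`, `τ g s − s ∈ 𝔪_x` for all `g ∈ I`,
`s ∈ 𝒪_{X,x}` (✓`InertLocusStalk.mem_inertiaSubgroup_fromSpecStalk_iff_of_action` at the closed point). [folklore] -/
theorem stalkAction_residueTrivial (hI : I ≤ inertiaSubgroup σ x) (g : I) (s : X.presheaf.stalk x) :
    τ g s - s ∈ maximalIdeal (X.presheaf.stalk x) := by
  have h := mem_inertiaSubgroup_fromSpecStalk_iff_of_action σ x a τ hkey hτ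
    (closedPoint (X.presheaf.stalk x)) g
  rw [Scheme.fromSpecStalk_closedPoint] at h
  exact (h.mp (hI g.2)) s

end StalkAction

/-! ## The end-state criteria for inertia groups -/

section EndState

variable {X : Scheme.{0}} {G : Type} [Group G] [Finite G] (σ : G →* Aut X) (hσ : Function.Injective σ)
  [IsIntegral X] [IsLocallyNoetherian X] {Y : Scheme.{0}} (r : X ⟶ Y) [IsSeparated r]
  (hr : ∀ g : G, (σ g).hom ≫ r = r) (p : ℕ) [Fact p.Prime] (x : X)
  [CharP (ResidueField (X.presheaf.stalk x)) p]

include hσ hr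

/-- **Toral end state ⟹ p-closed inertia** (crux stmt-ResolutionOfSingularities-15640, toward
`stub_phaseZeroHighDim`; any dimension). Let the finite group `G` act faithfully on the integral locally Noetherian
scheme `X` over the separated `r : X → Y`, and let `x` be a point of residue characteristic `p`. Suppose that for
the stalk action `(a, τ)` of the inertia group `I_x` on `𝒪_{X,x}` (✓`exists_stalkAction`; any such package) there
are `z₁, …, z_n ∈ 𝔪_x` with each `(zᵢ) + 𝔪_x²` stable under `I_x` (local equations of the `G`-stable boundary
divisors / mirrors through `x`) such that every element of `I_x` of order prime to `p` acts trivially on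
`𝔪_x / ((z₁, …, z_n) + 𝔪_x²)`. Then `I_x` has a normal Sylow `p`-subgroup. (✓p817841 through `stalkAction_injective`,
`stalkAction_residueTrivial`.) [folklore] -/
theorem hasNormalSylow_inertia_of_toralBoundary
    (hend : ∀ (a : inertiaSubgroup σ x → (X.presheaf.stalk x ⟶ X.presheaf.stalk x))
      (τ : inertiaSubgroup σ x →* (X.presheaf.stalk x ≃+* X.presheaf.stalk x)),
      (∀ g : inertiaSubgroup σ x,
        Spec.map (a g) ≫ X.fromSpecStalk x = X.fromSpecStalk x ≫ (σ (g : G)).hom) →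
      (∀ (g : inertiaSubgroup σ x) (s : X.presheaf.stalk x), τ g s = (a g⁻¹).hom s) →
      ∃ (n : ℕ) (z : Fin n → X.presheaf.stalk x), (∀ i, z i ∈ maximalIdeal (X.presheaf.stalk x)) ∧
        (∀ (g : inertiaSubgroup σ x) (i : Fin n),
          τ g (z i) ∈ Ideal.span {z i} ⊔ maximalIdeal (X.presheaf.stalk x) ^ 2) ∧
        (∀ g : inertiaSubgroup σ x, (orderOf g).Coprime p → ∀ w ∈ maximalIdeal (X.presheaf.stalk x),
          τ g w - w ∈ Ideal.span (Set.range z) ⊔ maximalIdeal (X.presheaf.stalk x) ^ 2)) :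
    HasNormalSylow p (inertiaSubgroup σ x) := by
  obtain ⟨a, τ, hkey, hτ⟩ := exists_stalkAction σ x (inertiaSubgroup σ x)
    (fun g hg => apply_eq_of_mem_inertiaSubgroup σ hg)
  have hinj : Function.Injective τ := stalkAction_injective σ x a τ hkey hτ r hr hσ
  have hres : ∀ (g : inertiaSubgroup σ x) (s : X.presheaf.stalk x),
      τ g s - s ∈ maximalIdeal (X.presheaf.stalk x) :=
    stalkAction_residueTrivial σ x a τ hkey hτ le_rfl
  obtain ⟨n, z, hz, hstab, htame⟩ := hend a τ hkey hτ
  exact TameEndState.hasNormalSylow_of_tame_trivial_mod_boundary p hinj hres z hz hstab htame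

/-- **Corank ≤ 1 end state ⟹ p-closed inertia**: as `hasNormalSylow_inertia_of_toralBoundary`, the last
hypothesis replaced by: ONE further element `w ∈ 𝔪_x` spans `𝔪_x` modulo `(z) + 𝔪_x²` (the point lies on at least
`edim − 1` stable boundary divisors; ✓p819336 `…_of_boundary_corank_le_one`). [folklore] -/
theorem hasNormalSylow_inertia_of_boundaryCorankLEOne
    (hend : ∀ (a : inertiaSubgroup σ x → (X.presheaf.stalk x ⟶ X.presheaf.stalk x))
      (τ : inertiaSubgroup σ x →* (X.presheaf.stalk x ≃+* X.presheaf.stalk x)),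
      (∀ g : inertiaSubgroup σ x,
        Spec.map (a g) ≫ X.fromSpecStalk x = X.fromSpecStalk x ≫ (σ (g : G)).hom) →
      (∀ (g : inertiaSubgroup σ x) (s : X.presheaf.stalk x), τ g s = (a g⁻¹).hom s) →
      ∃ (n : ℕ) (z : Fin n → X.presheaf.stalk x) (w : X.presheaf.stalk x),
        (∀ i, z i ∈ maximalIdeal (X.presheaf.stalk x)) ∧
        (∀ (g : inertiaSubgroup σ x) (i : Fin n),
          τ g (z i) ∈ Ideal.span {z i} ⊔ maximalIdeal (X.presheaf.stalk x) ^ 2) ∧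
        w ∈ maximalIdeal (X.presheaf.stalk x) ∧
        (∀ v ∈ maximalIdeal (X.presheaf.stalk x), ∃ c : X.presheaf.stalk x,
          v - c * w ∈ Ideal.span (Set.range z) ⊔ maximalIdeal (X.presheaf.stalk x) ^ 2)) :
    HasNormalSylow p (inertiaSubgroup σ x) := by
  obtain ⟨a, τ, hkey, hτ⟩ := exists_stalkAction σ x (inertiaSubgroup σ x)
    (fun g hg => apply_eq_of_mem_inertiaSubgroup σ hg)
  have hinj : Function.Injective τ := stalkAction_injective σ x a τ hkey hτ r hr hσ
  have hres : ∀ (g : inertiaSubgroup σ x) (s : X.presheaf.stalk x),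
      τ g s - s ∈ maximalIdeal (X.presheaf.stalk x) :=
    stalkAction_residueTrivial σ x a τ hkey hτ le_rfl
  obtain ⟨n, z, w, hz, hstab, hw, hgen⟩ := hend a τ hkey hτ
  exact TameEndState.hasNormalSylow_of_boundary_corank_le_one p hinj hres z hz hstab hw hgen

/-- **Vertex ⟹ p-closed inertia**: if the stable boundary equations through `x` already span the cotangent space
`𝔪_x/𝔪_x²` (the point is a vertex of the boundary), `I_x` is p-closed (✓p819336 `…_of_stable_parameters`).
[folklore] -/
theorem hasNormalSylow_inertia_of_stableParameters
    (hend : ∀ (a : inertiaSubgroup σ x → (X.presheaf.stalk x ⟶ X.presheaf.stalk x))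
      (τ : inertiaSubgroup σ x →* (X.presheaf.stalk x ≃+* X.presheaf.stalk x)),
      (∀ g : inertiaSubgroup σ x,
        Spec.map (a g) ≫ X.fromSpecStalk x = X.fromSpecStalk x ≫ (σ (g : G)).hom) →
      (∀ (g : inertiaSubgroup σ x) (s : X.presheaf.stalk x), τ g s = (a g⁻¹).hom s) →
      ∃ (n : ℕ) (z : Fin n → X.presheaf.stalk x),
        (∀ i, z i ∈ maximalIdeal (X.presheaf.stalk x)) ∧
        (∀ (g : inertiaSubgroup σ x) (i : Fin n),
          τ g (z i) ∈ Ideal.span {z i} ⊔ maximalIdeal (X.presheaf.stalk x) ^ 2) ∧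
        maximalIdeal (X.presheaf.stalk x) ≤
          Ideal.span (Set.range z) ⊔ maximalIdeal (X.presheaf.stalk x) ^ 2) :
    HasNormalSylow p (inertiaSubgroup σ x) := by
  obtain ⟨a, τ, hkey, hτ⟩ := exists_stalkAction σ x (inertiaSubgroup σ x)
    (fun g hg => apply_eq_of_mem_inertiaSubgroup σ hg)
  have hinj : Function.Injective τ := stalkAction_injective σ x a τ hkey hτ r hr hσ
  have hres : ∀ (g : inertiaSubgroup σ x) (s : X.presheaf.stalk x),
      τ g s - s ∈ maximalIdeal (X.presheaf.stalk x) :=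
    stalkAction_residueTrivial σ x a τ hkey hτ le_rfl
  obtain ⟨n, z, hz, hstab, hspan⟩ := hend a τ hkey hτ
  exact TameEndState.hasNormalSylow_of_stable_parameters p hinj hres z hz hstab hspan

end EndState

end Summit.ResolutionOfSingularities.ResolutionOfSingularities.Theorems.WildQuotientResolution.InertLocusStalk

end
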